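import Summits.HodgeConjecture.HodgeConjecture.Theorems.PadicSemiregularLiftHodgeFermatVarietiesLatticeCriterion
import Summits.HodgeConjecture.HodgeConjecture.Theorems.PadicSemiregularLiftHodgeFermatVarietiesPrintedSupply
import Summits.HodgeConjecture.HodgeConjecture.Theorems.PadicSemiregularLiftHodgeFermatVarietiesLevelRaise
import HarnessLib

/-!
# D39: every Hodge multiset of `ℤ/39` is reachable at its own level — HC for the Fermat varieties of degree 39 modulo the stubs

Crux `HodgeFermatVarieties` (stmt-HodgeConjecture-1334), line `cancel-by-any-claim-lattice`; the
degree-`39` companion of `…Saturation33` / `…Saturation99` (`39 = 3·13`: not a prime power, `> 21`, `≠ 27`,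
not of the form `2ᵃ3ᵇ5ᶜ7ᵈ`, divisible by `3` — no theorem in print covers `Xⁿ₃₉`). Degree `39` is
SATURATED ALREADY AT ITS OWN LEVEL (census: index 1, `k = 1`), and here Shioda's semi-decomposable
supply is genuinely used (three sextuples). PROVED:

    reach_thirtyNine       : IsHodgeMultiset s → Reach[39, s]
    stableReach_thirtyNine : IsHodgeMultiset s → StableReach[39, s]
    hodgeConjectureFor_thirtyNine : HC for every smooth projective Fermat variety of degree 39,
      granted the six S0 named facts and the statements of the stubs S2↑, S2↓, S3a, S5.

Certificate (lead's `calc/d99.py 39 --semi`, exact; checked by the kernel): the Hodge lattice `L₃₉`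
(rank 26; pivots `1,…,11,13`) is a graph over `F` with `±1` relations (12 unit-combination
certificates over the 12 units `< 39/2`, scales `78`, `156`); each basis vector `v_a = A a − B a` has a
reach certificate `A a + Σ(N39 a) = B a + Σ(P39 a)` over 38 supply elements of level `39` (16 pairs,
19 Hodge 4-multisets, 3 semi-decomposable Hodge sextuples).

References: [Shioda1979PJA] Proc. Japan Acad. 55A (1979) §1; [Aoki1987] J. Math. Soc. Japan 39 (1987) Thm 1-4, 2-1.
-/

set_option linter.dupNamespace false

noncomputable section

open Finset
open Literature.AlgebraicGeometry.HodgeTheory Literature.AlgebraicGeometry.HodgeTheory.FermatCharacter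

namespace Summit.HodgeConjecture.HodgeConjecture.Theorems.CancelByAnyClaimLattice.D39

/-- `Supply[M]` — the printed supply of level `M` (local notation of the line, verbatim). -/
local notation3 (prettyPrint := false) "Supply[" M "]" =>
  ({s : Multiset (ZMod M) | ∃ a : ZMod M, a ≠ 0 ∧ s = ({a, -a} : Multiset (ZMod M))} ∪
    {s : Multiset (ZMod M) | IsHodgeMultiset s ∧ Multiset.card s = 4} ∪
    {s : Multiset (ZMod M) | IsHodgeMultiset s ∧ IsSemiDecomposable s} ∪
    {s : Multiset (ZMod M) | ∃ (p : ℕ) (a : ZMod M), p.Prime ∧ p ≠ 2 ∧ p ∣ M ∧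
        2 < (M / p) / Nat.gcd (ZMod.val a) (M / p) ∧
        s = Multiset.map (fun j : ℕ => a + (j : ZMod M) * ((M / p : ℕ) : ZMod M)) (Multiset.range p) +
              {-((p : ZMod M) * a)}} : Set (Multiset (ZMod M)))

/-- `Reach[M, s]` (local notation of the line, verbatim). -/
local notation3 (prettyPrint := false) "Reach[" M ", " s "]" =>
  ∃ P N : Multiset (Multiset (ZMod M)),
    (∀ u ∈ P, u ∈ Supply[M]) ∧ (∀ u ∈ N, u ∈ Supply[M]) ∧ s + Multiset.sum N = Multiset.sum P

/-- `LevelRaise[k, m, s]` (local notation of the line, verbatim). -/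
local notation3 (prettyPrint := false) "LevelRaise[" k ", " m ", " s "]" =>
  Multiset.map (fun a : ZMod m => ((k * ZMod.val a : ℕ) : ZMod (k * m))) s

/-- `StableReach[m, s]` (local notation of the line, verbatim). -/
local notation3 (prettyPrint := false) "StableReach[" m ", " s "]" => ∃ k : ℕ, 0 < k ∧ Reach[k * m, LevelRaise[k, m, s]]

/-! ### §1 Tables (computed; every numeric fact re-checked below by `decide`) -/

/-- The 26 FREE residues `F` of `ℤ/39` (the Hodge lattice `L₃₉`, rank 26, is a graph over them). [folklore] -/
def Fset : Finset (ZMod 39) := {12, 14, 15, 16, 17, 18, 19, 20, 21, 22, 23, 24, 25, 26, 27, 28, 29, 30, 31, 32, 33, 34, 35, 36, 37, 38}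

/-- The 12 PIVOT residues. [folklore] -/
def Pset : Finset (ZMod 39) := {1, 2, 3, 4, 5, 6, 7, 8, 9, 10, 11, 13}

/-- `A a` — positive part of the graph-basis vector `v_a` (`a ∈ F`); `0` off `F`. (Computed: `calc/d99.py 39 --semi`.) [folklore] -/
def A (a : ZMod 39) : Multiset (ZMod 39) :=
  if a = 12 then ({2, 3, 5, 12} : Multiset (ZMod 39)) else
  if a = 14 then ({2, 5, 14} : Multiset (ZMod 39)) else
  if a = 15 then ({2, 15} : Multiset (ZMod 39)) else
  if a = 16 then ({3, 16} : Multiset (ZMod 39)) else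
  if a = 17 then ({2, 3, 5, 17} : Multiset (ZMod 39)) else
  if a = 18 then ({2, 5, 18} : Multiset (ZMod 39)) else
  if a = 19 then ({2, 5, 19} : Multiset (ZMod 39)) else
  if a = 20 then ({7, 8, 11, 20} : Multiset (ZMod 39)) else
  if a = 21 then ({6, 8, 11, 21} : Multiset (ZMod 39)) else
  if a = 22 then ({1, 7, 9, 10, 22} : Multiset (ZMod 39)) else
  if a = 23 then ({9, 10, 23} : Multiset (ZMod 39)) else
  if a = 24 then ({6, 11, 24} : Multiset (ZMod 39)) else
  if a = 25 then ({4, 7, 10, 25} : Multiset (ZMod 39)) else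
  if a = 26 then ({13, 26} : Multiset (ZMod 39)) else
  if a = 27 then ({1, 4, 7, 10, 27} : Multiset (ZMod 39)) else
  if a = 28 then ({11, 28} : Multiset (ZMod 39)) else
  if a = 29 then ({10, 29} : Multiset (ZMod 39)) else
  if a = 30 then ({9, 30} : Multiset (ZMod 39)) else
  if a = 31 then ({8, 31} : Multiset (ZMod 39)) else
  if a = 32 then ({7, 32} : Multiset (ZMod 39)) else
  if a = 33 then ({6, 33} : Multiset (ZMod 39)) else
  if a = 34 then ({5, 34} : Multiset (ZMod 39)) else
  if a = 35 then ({4, 35} : Multiset (ZMod 39)) else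
  if a = 36 then ({3, 36} : Multiset (ZMod 39)) else
  if a = 37 then ({2, 37} : Multiset (ZMod 39)) else
  if a = 38 then ({1, 38} : Multiset (ZMod 39)) else 0

/-- `B a` — negative part of `v_a = A a − B a`. [folklore] -/
def B (a : ZMod 39) : Multiset (ZMod 39) :=
  if a = 12 then ({1, 4, 7, 10} : Multiset (ZMod 39)) else
  if a = 14 then ({4, 7, 10} : Multiset (ZMod 39)) else
  if a = 15 then ({6, 11} : Multiset (ZMod 39)) else
  if a = 16 then ({9, 10} : Multiset (ZMod 39)) else
  if a = 17 then ({1, 7, 9, 10} : Multiset (ZMod 39)) else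
  if a = 18 then ({6, 8, 11} : Multiset (ZMod 39)) else
  if a = 19 then ({7, 8, 11} : Multiset (ZMod 39)) else
  if a = 20 then ({2, 5} : Multiset (ZMod 39)) else
  if a = 21 then ({2, 5} : Multiset (ZMod 39)) else
  if a = 22 then ({2, 3, 5} : Multiset (ZMod 39)) else
  if a = 23 then ({3} : Multiset (ZMod 39)) else
  if a = 24 then ({2} : Multiset (ZMod 39)) else
  if a = 25 then ({2, 5} : Multiset (ZMod 39)) else
  if a = 27 then ({2, 3, 5} : Multiset (ZMod 39)) else 0

/-- `relCert p` — unit-combination certificate `(t, t⁻¹, μ_t)` of the relation for the pivot `p` (scale `relD p`). [folklore] -/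
def relCert (p : ZMod 39) : List (ZMod 39 × ZMod 39 × ℤ) :=
  if p = 1 then [(1, 1, -1), (2, 20, 1), (4, 10, -1), (5, 8, -1), (7, 28, -1), (8, 5, -1), (10, 4, -1), (11, 32, -1), (14, 14, -1), (16, 22, 1), (17, 23, -1), (19, 37, -1)] else
  if p = 2 then [(1, 1, 1), (2, 20, -2), (11, 32, 1), (14, 14, 1), (17, 23, 1)] else
  if p = 3 then [(2, 20, -1), (8, 5, 1), (10, 4, 1), (16, 22, -1)] else
  if p = 4 then [(1, 1, -1), (2, 20, 1), (4, 10, -1), (5, 8, 1), (7, 28, 1), (8, 5, 1), (10, 4, -1), (11, 32, -1), (14, 14, -1), (16, 22, 1), (17, 23, -1), (19, 37, 1)] else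
  if p = 5 then [(1, 1, 1), (2, 20, -3), (4, 10, 1), (5, 8, 1), (7, 28, 1), (8, 5, -1), (10, 4, -1), (11, 32, 1), (14, 14, 1), (16, 22, -1), (17, 23, 1), (19, 37, -1)] else
  if p = 6 then [(1, 1, -1), (2, 20, 1), (4, 10, 1), (5, 8, 1), (7, 28, -1), (8, 5, -1), (10, 4, 1), (11, 32, -1), (14, 14, -1), (16, 22, -1), (17, 23, 1), (19, 37, 1)] else
  if p = 7 then [(1, 1, -1), (2, 20, 1), (16, 22, 1), (17, 23, -1)] else
  if p = 8 then [(1, 1, -1), (2, 20, 1), (4, 10, 1), (5, 8, -1), (7, 28, -1), (8, 5, 1), (10, 4, 1), (11, 32, -1), (14, 14, 1), (16, 22, -1), (17, 23, -1), (19, 37, 1)] else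
  if p = 9 then [(1, 1, -1), (2, 20, 1), (4, 10, 1), (5, 8, -1), (7, 28, 1), (8, 5, -1), (10, 4, -1), (11, 32, 1), (14, 14, -1), (16, 22, 1), (17, 23, 1), (19, 37, -1)] else
  if p = 10 then [(1, 1, -1), (2, 20, 3), (4, 10, -1), (5, 8, -1), (7, 28, 1), (8, 5, -1), (10, 4, -1), (11, 32, 1), (14, 14, -1), (16, 22, 1), (17, 23, -1), (19, 37, 1)] else
  if p = 11 then [(1, 1, -1), (2, 20, 1), (10, 4, 1), (11, 32, -1)] else
  if p = 13 then [(1, 1, -1), (2, 20, 1), (4, 10, -1), (5, 8, 1), (7, 28, -1), (8, 5, 1), (10, 4, -1), (11, 32, 1), (14, 14, 1), (16, 22, -1), (17, 23, 1), (19, 37, -1)] else []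

/-- `relD p` — the scale of the relation certificate (`78` or `156`). [folklore] -/
def relD (p : ZMod 39) : ℤ := if p = 2 then 78 else if p = 3 then 78 else if p = 7 then 78 else if p = 11 then 78 else 156

/-- `P39 a` — positive supply part of the level-39 reach certificate of `v_a` (`a ∈ F`). [folklore] -/
def P39 (a : ZMod 39) : Multiset (Multiset (ZMod 39)) :=
  if a = 12 then {({2, 5, 34, 37} : Multiset (ZMod 39))} + {({3, 16, 29, 30} : Multiset (ZMod 39))} + {({12, 17, 22, 27} : Multiset (ZMod 39))} else
  if a = 14 then {({2, 5, 34, 37} : Multiset (ZMod 39))} + {({1, 14, 16, 22, 29, 35} : Multiset (ZMod 39))} else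
  if a = 15 then {({2, 15, 28, 33} : Multiset (ZMod 39))} else
  if a = 16 then {({3, 16, 29, 30} : Multiset (ZMod 39))} else
  if a = 17 then {({17, 22} : Multiset (ZMod 39))} + {({2, 5, 34, 37} : Multiset (ZMod 39))} + {({3, 16, 29, 30} : Multiset (ZMod 39))} else
  if a = 18 then {({2, 15, 28, 33} : Multiset (ZMod 39))} + {({5, 18, 24, 31} : Multiset (ZMod 39))} else
  if a = 19 then {({2, 15, 28, 33} : Multiset (ZMod 39))} + {({5, 18, 24, 31} : Multiset (ZMod 39))} + {({6, 19, 21, 32} : Multiset (ZMod 39))} else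
  if a = 20 then {({19, 20} : Multiset (ZMod 39))} + {({6, 7, 32, 33} : Multiset (ZMod 39))} + {({8, 11, 28, 31} : Multiset (ZMod 39))} + {({15, 18, 21, 24} : Multiset (ZMod 39))} else
  if a = 21 then {({18, 21} : Multiset (ZMod 39))} + {({6, 8, 31, 33} : Multiset (ZMod 39))} + {({11, 15, 24, 28} : Multiset (ZMod 39))} else
  if a = 22 then {({9, 10, 29, 30} : Multiset (ZMod 39))} + {({1, 7, 16, 22, 34, 37} : Multiset (ZMod 39))} else
  if a = 23 then {({9, 10, 23, 36} : Multiset (ZMod 39))} else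
  if a = 24 then {({6, 11, 24, 37} : Multiset (ZMod 39))} else
  if a = 25 then {({14, 25} : Multiset (ZMod 39))} + {({4, 10, 29, 35} : Multiset (ZMod 39))} + {({1, 7, 16, 22, 34, 37} : Multiset (ZMod 39))} else
  if a = 26 then {({13, 26} : Multiset (ZMod 39))} else
  if a = 27 then {({1, 14, 27, 36} : Multiset (ZMod 39))} + {({4, 7, 10, 25, 34, 37} : Multiset (ZMod 39))} else
  if a = 28 then {({11, 28} : Multiset (ZMod 39))} else
  if a = 29 then {({10, 29} : Multiset (ZMod 39))} else
  if a = 30 then {({9, 30} : Multiset (ZMod 39))} else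
  if a = 31 then {({8, 31} : Multiset (ZMod 39))} else
  if a = 32 then {({7, 32} : Multiset (ZMod 39))} else
  if a = 33 then {({6, 33} : Multiset (ZMod 39))} else
  if a = 34 then {({5, 34} : Multiset (ZMod 39))} else
  if a = 35 then {({4, 35} : Multiset (ZMod 39))} else
  if a = 36 then {({3, 36} : Multiset (ZMod 39))} else
  if a = 37 then {({2, 37} : Multiset (ZMod 39))} else
  if a = 38 then {({1, 38} : Multiset (ZMod 39))} else 0

/-- `N39 a` — negative supply part of the level-39 reach certificate of `v_a` (`a ∈ F`). [folklore] -/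
def N39 (a : ZMod 39) : Multiset (Multiset (ZMod 39)) :=
  if a = 12 then {({10, 29} : Multiset (ZMod 39))} + {({4, 17, 27, 30} : Multiset (ZMod 39))} + {({1, 7, 16, 22, 34, 37} : Multiset (ZMod 39))} else
  if a = 14 then {({4, 10, 29, 35} : Multiset (ZMod 39))} + {({1, 7, 16, 22, 34, 37} : Multiset (ZMod 39))} else
  if a = 15 then {({6, 11, 28, 33} : Multiset (ZMod 39))} else
  if a = 16 then {({9, 10, 29, 30} : Multiset (ZMod 39))} else
  if a = 17 then {({9, 10, 29, 30} : Multiset (ZMod 39))} + {({1, 7, 16, 22, 34, 37} : Multiset (ZMod 39))} else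
  if a = 18 then {({6, 8, 31, 33} : Multiset (ZMod 39))} + {({11, 15, 24, 28} : Multiset (ZMod 39))} else
  if a = 19 then {({6, 7, 32, 33} : Multiset (ZMod 39))} + {({8, 11, 28, 31} : Multiset (ZMod 39))} + {({15, 18, 21, 24} : Multiset (ZMod 39))} else
  if a = 20 then {({2, 15, 28, 33} : Multiset (ZMod 39))} + {({5, 18, 24, 31} : Multiset (ZMod 39))} + {({6, 19, 21, 32} : Multiset (ZMod 39))} else
  if a = 21 then {({2, 15, 28, 33} : Multiset (ZMod 39))} + {({5, 18, 24, 31} : Multiset (ZMod 39))} else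
  if a = 22 then {({2, 5, 34, 37} : Multiset (ZMod 39))} + {({3, 16, 29, 30} : Multiset (ZMod 39))} else
  if a = 23 then {({3, 36} : Multiset (ZMod 39))} else
  if a = 24 then {({2, 37} : Multiset (ZMod 39))} else
  if a = 25 then {({2, 5, 34, 37} : Multiset (ZMod 39))} + {({1, 14, 16, 22, 29, 35} : Multiset (ZMod 39))} else
  if a = 27 then {({2, 5, 34, 37} : Multiset (ZMod 39))} + {({3, 14, 25, 36} : Multiset (ZMod 39))} else 0

/-- The three semi-decomposable Hodge sextuples of `ℤ/39` used by the certificates, with their zero-sum triples. [cite: Shioda1979PJA, §1 Definition (iii)] -/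
def SemiList39 : List (Multiset (ZMod 39) × Multiset (ZMod 39)) :=
  [(({1, 16, 22} : Multiset (ZMod 39)), ({7, 34, 37} : Multiset (ZMod 39))), (({1, 16, 22} : Multiset (ZMod 39)), ({14, 29, 35} : Multiset (ZMod 39))), (({4, 10, 25} : Multiset (ZMod 39)), ({7, 34, 37} : Multiset (ZMod 39)))]

/-! ### §2 Relations and the graph identity -/

/-- `vTab a x = v_a(x)`. [folklore] -/
def vTab (a x : ZMod 39) : ℤ := (Multiset.count x (A a) : ℤ) - (Multiset.count x (B a) : ℤ)

/-- The relation attached to a pivot `p`. [folklore] -/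
def relW (p x : ZMod 39) : ℤ := (if x = p then 1 else 0) - (if x ∈ Fset then vTab x p else 0)

set_option maxRecDepth 100000 in set_option maxHeartbeats 1000000 in
/-- Every residue is `0`, free, or a pivot. [folklore] -/
theorem trichotomy : ∀ x : ZMod 39, x = 0 ∨ x ∈ Fset ∨ x ∈ Pset := by unfold Fset Pset; decide +kernel

set_option maxRecDepth 100000 in set_option maxHeartbeats 1000000 in
/-- On `F × F` the graph basis is the identity matrix. [folklore] -/
theorem vTab_F : ∀ x ∈ Fset, ∀ a ∈ Fset, vTab a x = if a = x then 1 else 0 := by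
  unfold vTab A B Fset; decide +kernel

set_option maxRecDepth 100000 in set_option maxHeartbeats 1000000 in
/-- The basis vectors have no `0`-coordinate. [folklore] -/
theorem vTab_zero : ∀ a ∈ Fset, vTab a 0 = 0 := by unfold vTab A B Fset; decide +kernel

set_option maxRecDepth 100000 in set_option maxHeartbeats 1000000 in
/-- The certificate entries are units with the listed inverses, the scales are non-zero. [folklore] -/
theorem relCert_units : ∀ p ∈ Pset, (∀ e ∈ relCert p, e.1 * e.2.1 = 1) ∧ relD p ≠ 0 := by
  unfold relCert relD Pset; decide +kernel

set_option maxRecDepth 100000 in set_option maxHeartbeats 1000000 in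
/-- **The twelve weight tables.** [folklore] -/
theorem relCert_table : ∀ p ∈ Pset, ∀ x : ZMod 39, x ≠ 0 →
    ((relCert p).map fun e ↦ e.2.2 * (2 * (((e.1 * x).val : ℕ) : ℤ))).sum =
      ((39 : ℕ) : ℤ) * ((relCert p).map fun e ↦ e.2.2).sum + relD p * relW p x := by
  unfold relCert relD relW vTab A B Fset Pset; decide +kernel

/-- **Graph decomposition**: `c_x(s) = Σ_{a ∈ F} c_a(s) · v_a(x)` for every residue `x`. [folklore] -/
theorem count_eq_sum_graph {s : Multiset (ZMod 39)} (hs : IsHodgeMultiset s) (x : ZMod 39) :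
    (Multiset.count x s : ℤ) = ∑ a ∈ Fset, (Multiset.count a s : ℤ) * vTab a x := by
  rcases trichotomy x with rfl | hx | hx
  · rw [Finset.sum_eq_zero fun a ha ↦ by rw [vTab_zero a ha, mul_zero]]
    exact_mod_cast Multiset.count_eq_zero.2 fun h0 ↦ hs.1.1 0 h0 rfl
  · rw [Finset.sum_congr rfl fun a ha ↦ by rw [vTab_F x hx a ha]]
    simp only [mul_ite, mul_one, mul_zero, Finset.sum_ite_eq' Fset x, if_pos hx]
  · have h := sum_count_mul_eq_zero_of_cert (relCert x) (relCert_units x hx).1 (relW x) (relCert_units x hx).2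
      (relCert_table x hx) hs
    simp only [relW, mul_sub, Finset.sum_sub_distrib, mul_ite, mul_one, mul_zero, Finset.sum_ite_eq',
      Finset.mem_univ, if_true, Finset.sum_ite_mem, Finset.univ_inter] at h
    linarith

/-- **The graph identity as multisets**: `s + Σ_{a∈F} c_a • B a = Σ_{a∈F} c_a • A a`. [folklore] -/
theorem graph_identity39 :
    ∀ {s : Multiset (ZMod 39)}, IsHodgeMultiset s → s + ∑ a ∈ Fset, Multiset.count a s • B a = ∑ a ∈ Fset, Multiset.count a s • A a := by
  intro s hs
  ext x
  have h := count_eq_sum_graph hs x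
  simp only [vTab, mul_sub, Finset.sum_sub_distrib] at h
  rw [Multiset.count_add, Multiset.count_sum', Multiset.count_sum']
  simp only [Multiset.count_nsmul]
  have h' : ((Multiset.count x s + ∑ a ∈ Fset, Multiset.count a s * Multiset.count x (B a) : ℕ) : ℤ) =
      ((∑ a ∈ Fset, Multiset.count a s * Multiset.count x (A a) : ℕ) : ℤ) := by
    push_cast; linarith
  exact_mod_cast h'

/-! ### §3 The level-39 certificates and the assembly -/

/-- Hodge multisets of level `39` are decidable. [folklore] -/
local instance decIsHodgeMultiset39 (s : Multiset (ZMod 39)) : Decidable (IsHodgeMultiset s) := by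
  unfold IsHodgeMultiset mNormSum; infer_instance

/-- `CertShape39[u]`: a pair, a Hodge 4-multiset, or one of the three listed semi-decomposable sextuples. -/
local notation3 (prettyPrint := false) "CertShape39[" u "]" =>
  ((∃ a : ZMod 39, a ≠ 0 ∧ u = ({a, -a} : Multiset (ZMod 39))) ∨ (IsHodgeMultiset u ∧ Multiset.card u = 4) ∨
    u ∈ SemiList39.map (fun tu ↦ tu.1 + tu.2))

/-- The listed sextuples are Hodge and semi-decomposable (two zero-sum triples each). [cite: Shioda1979PJA, §1 (iii)] -/
theorem semiList39_ok : ∀ tu ∈ SemiList39, IsHodgeMultiset (tu.1 + tu.2) ∧ Multiset.card tu.1 = 3 ∧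
    Multiset.card tu.2 = 3 ∧ tu.1.sum = 0 ∧ tu.2.sum = 0 := by
  unfold SemiList39; decide +kernel

/-- Every certificate shape is a supply element of level `39`. [folklore] -/
theorem mem_supply_of_certShape39 {u : Multiset (ZMod 39)} (h : CertShape39[u]) : u ∈ Supply[39] := by
  rcases h with h | h | h
  · exact Or.inl (Or.inl (Or.inl h))
  · exact Or.inl (Or.inl (Or.inr h))
  · obtain ⟨tu, htu, rfl⟩ := List.mem_map.1 h
    obtain ⟨hH, h1, h2, h3, h4⟩ := semiList39_ok tu htu
    exact Or.inl (Or.inr ⟨hH, tu.1, tu.2, h1, h2, h3, h4, rfl⟩)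

set_option maxRecDepth 100000 in set_option maxHeartbeats 1000000 in
/-- **The 26 basis certificates** (level `39`): `A a + Σ(N39 a) = B a + Σ(P39 a)`. [folklore] -/
theorem cert39_of_mem_F : ∀ a ∈ Fset, A a + (N39 a).sum = B a + (P39 a).sum := by
  unfold Fset A B N39 P39; decide +kernel

set_option maxRecDepth 100000 in set_option maxHeartbeats 1000000 in
/-- All 38 generators used have a certificate shape. [folklore] -/
theorem certShape_of_mem_F39 : ∀ a ∈ Fset, ∀ u ∈ P39 a + N39 a, CertShape39[u] := by
  unfold Fset P39 N39 SemiList39; decide +kernel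

set_option maxRecDepth 100000 in set_option maxHeartbeats 1000000 in
/-- **D39 — every Hodge multiset of `ℤ/39` is ℤ-reachable from the printed supply of level `39`.** [folklore] -/
theorem reach_thirtyNine (s : Multiset (ZMod 39)) (hs : IsHodgeMultiset s) : Reach[39, s] := by
  obtain ⟨c, hc⟩ : ∃ c : ZMod 39 → ℕ, c = fun a ↦ Multiset.count a s := ⟨_, rfl⟩
  have hI : s + ∑ a ∈ Fset, c a • B a = ∑ a ∈ Fset, c a • A a := by rw [hc]; exact graph_identity39 hs
  refine ⟨∑ a ∈ Fset, c a • P39 a, ∑ a ∈ Fset, c a • N39 a, ?_, ?_, ?_⟩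
  · intro u hu
    obtain ⟨a, ha, hu⟩ := Multiset.mem_sum.1 hu
    exact mem_supply_of_certShape39 (certShape_of_mem_F39 a ha u (Multiset.mem_add.2 (Or.inl (Multiset.mem_of_mem_nsmul hu))))
  · intro u hu
    obtain ⟨a, ha, hu⟩ := Multiset.mem_sum.1 hu
    exact mem_supply_of_certShape39 (certShape_of_mem_F39 a ha u (Multiset.mem_add.2 (Or.inr (Multiset.mem_of_mem_nsmul hu))))
  · have hII : ∑ a ∈ Fset, c a • (A a + (N39 a).sum) = ∑ a ∈ Fset, c a • (B a + (P39 a).sum) :=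
      Finset.sum_congr rfl fun a ha ↦ by rw [cert39_of_mem_F a ha]
    simp only [nsmul_add, Finset.sum_add_distrib] at hII
    rw [sum_sum_nsmul, sum_sum_nsmul]
    have key : s + (∑ a ∈ Fset, c a • (N39 a).sum) + ∑ a ∈ Fset, c a • B a =
        (∑ a ∈ Fset, c a • (P39 a).sum) + ∑ a ∈ Fset, c a • B a := by
      calc s + (∑ a ∈ Fset, c a • (N39 a).sum) + ∑ a ∈ Fset, c a • B a
          = (s + ∑ a ∈ Fset, c a • B a) + ∑ a ∈ Fset, c a • (N39 a).sum := by abel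
        _ = (∑ a ∈ Fset, c a • A a) + ∑ a ∈ Fset, c a • (N39 a).sum := by rw [hI]
        _ = (∑ a ∈ Fset, c a • (P39 a).sum) + ∑ a ∈ Fset, c a • B a := by rw [hII]; abel
    exact add_right_cancel key

/-- Level raising by `k = 1` is the identity. [folklore] -/
theorem levelRaise_one (s : Multiset (ZMod 39)) : LevelRaise[1, 39, s] = s := by
  conv_rhs => rw [← Multiset.map_id s]
  refine Multiset.map_congr rfl fun a _ ↦ ?_
  simp only [one_mul, id_eq]
  exact ZMod.natCast_zmod_val a

/-- **Stable reachability in degree `39`** (`k = 1`). [folklore] -/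
theorem stableReach_thirtyNine : ∀ s : Multiset (ZMod 39), IsHodgeMultiset s → StableReach[39, s] :=
  fun s hs ↦ ⟨1, Nat.one_pos, by rw [levelRaise_one]; exact reach_thirtyNine s hs⟩

/-! ### §4 Pay-off -/

open CategoryTheory AlgebraicGeometry
open Literature.AlgebraicGeometry Literature.AlgebraicGeometry.Motives Literature.AlgebraicTopology.SingularHomology

/-- **Claim for every non-empty Hodge multiset of level `39`**, granted the named facts and the statements of
S2↑, S2↓, S3a (landed S1, S3b; proved S2 (a)). [folklore assembly] -/
theorem claimMultiset_thirtyNine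
    (hJ : Aoki1987_claim_juxtaposition) (hC : Aoki1987_claim_of_claim_juxtaposition_paired)
    (hP : Shioda_claim_paired) (hNS : AokiShioda1983_eigenline_le_neronSeveri) (hS : Aoki1987_claim_pStandard)
    (hPull : ∀ (m k r : ℕ) (α' : Fin (2 * r + 2) → ZMod m), 0 < k → (∀ i, α' i ≠ 0) →
      FermatCharacter.Claim m r α' → FermatCharacter.Claim (k * m) r (fun i => ((k * (α' i).val : ℕ) : ZMod (k * m))))
    (hPush : ∀ (m k r : ℕ) (α' : Fin (2 * r + 2) → ZMod m), 0 < k → (∀ i, α' i ≠ 0) →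
      FermatCharacter.Claim (k * m) r (fun i => ((k * (α' i).val : ℕ) : ZMod (k * m))) → FermatCharacter.Claim m r α')
    (h3a : ∀ (M : ℕ) [NeZero M] (s : Multiset (ZMod M)), IsHodgeMultiset s → IsSemiDecomposable s → ClaimMultiset M s)
    {s : Multiset (ZMod 39)} (hs0 : s ≠ 0) (hs : IsHodgeMultiset s) : ClaimMultiset 39 s := by
  have h2 : ∀ (m k : ℕ) [NeZero m], 0 < k → ∀ s : Multiset (ZMod m), s ≠ 0 → IsHodgeMultiset s →
      IsHodgeMultiset (LevelRaise[k, m, s]) ∧ (ClaimMultiset m s ↔ ClaimMultiset (k * m) (LevelRaise[k, m, s])) :=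
    fun m k _ hk s hs0 hs ↦ ⟨isHodgeMultiset_levelRaise m k hk s hs0 hs,
      claimMultiset_levelRaise_iff_of_pull_push hPull hPush m k hk s hs0 hs⟩
  obtain ⟨P, N, hPs, hNs, hEq⟩ := reach_thirtyNine s hs
  exact stub_latticeCriterion hJ hC 39 (Supply[39]) (stub_printedSupply hP hNS hS h3a h2 39) s P N hs0 hs hPs hNs hEq

/-- **HC FOR EVERY COMPLEX FERMAT VARIETY OF DEGREE `39`**, granted the six named facts of S0 and the statements of
the stubs S2↑, S2↓, S3a and S5 (Ran 1980 Prop. 1.7 at `m = 39`); no engine and no level change: degree `39` is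
saturated at its own level. [cite: Shioda1979PJA, §2 Thm. 1] [cite: Aoki1987, Thm 1-4, Thm 2-1] -/
theorem hodgeConjectureFor_thirtyNine
    (hJ : Aoki1987_claim_juxtaposition) (hC : Aoki1987_claim_of_claim_juxtaposition_paired)
    (hP : Shioda_claim_paired) (hNS : AokiShioda1983_eigenline_le_neronSeveri) (hS : Aoki1987_claim_pStandard)
    (hModel : ∀ (n : ℕ) (X : SchemeOver ℂ), nonempty_hodgeModel n X)
    (hPull : ∀ (m k r : ℕ) (α' : Fin (2 * r + 2) → ZMod m), 0 < k → (∀ i, α' i ≠ 0) →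
      FermatCharacter.Claim m r α' → FermatCharacter.Claim (k * m) r (fun i => ((k * (α' i).val : ℕ) : ZMod (k * m))))
    (hPush : ∀ (m k r : ℕ) (α' : Fin (2 * r + 2) → ZMod m), 0 < k → (∀ i, α' i ≠ 0) →
      FermatCharacter.Claim (k * m) r (fun i => ((k * (α' i).val : ℕ) : ZMod (k * m))) → FermatCharacter.Claim m r α')
    (h3a : ∀ (M : ℕ) [NeZero M] (s : Multiset (ZMod M)), IsHodgeMultiset s → IsSemiDecomposable s → ClaimMultiset M s)
    (h5 : ∀ ⦃p : ℕ⦄, 0 < p →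
      (∀ α : Fin (2 * p + 2) → ZMod 39, α ≠ 0 → (∃ i, α i = 0) → fermatEigenspace 39 α (2 * p) = ⊥) ∧
      (fermatEigenspace 39 (0 : Fin (2 * p + 2) → ZMod 39) (2 * p) ≤
        LinearMap.range (complexBetti.map (SmoothHypersurface.hypersurfaceι (fermatPolynomial ℂ (2 * p) 39)) (2 * p)).hom) ∧
      (∀ (A : HodgeModel (2 * p) (fermatHypersurface (2 * p) 39)) (β : Fin (2 * p + 2) → ZMod 39),
        (∀ i, β i ≠ 0) →
        (∃ x ∈ fermatEigenspace 39 β (2 * p), x ≠ 0 ∧ A.pullback (2 * p) x ∈ A.hodgePQ (2 * p) p p) →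
          2 * FermatCharacter.normSum β = 39 * (2 * p + 2)))
    ⦃n : ℕ⦄ ⦃X : SchemeOver ℂ⦄ (hF : IsFermatVariety n 39 X) (hX : IsSmoothProjective n X) :
    HodgeConjectureFor n X := by
  refine ⟨hModel n X hX, fun p c hc hpp ↦ ?_⟩
  refine hodgeClasses_algebraic_fermat_of_claims_at' (m := 39) h5 (fun p hp α hα ↦ ?_) hF hX p c hc hpp
  have hs : IsHodgeMultiset (univ.val.map α) := hα.isHodgeMultiset
  have hs0 : univ.val.map α ≠ 0 := by
    intro h0
    have hcard := congrArg Multiset.card h0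
    rw [card_univ_val_map, Multiset.card_zero] at hcard
    omega
  exact (claimMultiset_univ_val_map_iff α).1 (claimMultiset_thirtyNine hJ hC hP hNS hS hPull hPush h3a hs0 hs)

end Summit.HodgeConjecture.HodgeConjecture.Theorems.CancelByAnyClaimLattice.D39

end
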